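import Summits.FinalStateConjecture.FinalStateConjecture.Theses.EternalPapapetrou
import Literature.Geometry.Lorentzian.KillingHorizonShadowAlong

/-!
# Birth skeleton (BC3) for crux `EternalStationaryExteriorIsKerr` (stmt-FinalStateConjecture-10745),
# route `EternalPapapetrou` — "placement · Killing extension to the d.o.c. · stationary rigidity (hole / complete)"

planner-skel-stmt-FinalStateConjecture-10745-0 (skeleton registrar, route re-audit bin REPAIRABLE), 2026-08-17.
Target: the route decl `Summit.FinalStateConjecture.FinalStateConjecture.Theses.EternalPapapetrou.EternalStationaryExteriorIsKerr`
(U, rank 4, rev 10 of the route file) BY NAME, concluded by `EternalStationaryExteriorIsKerr_of` from four named stubs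
(hypothesis-free registered theorem, stubs used as lemmas; the curried reading `stub₁-sig → … → stub₄-sig → U` is the
`example` at the end, kernel-checked against the same proof).

## The line (the route's own two-layer plan "U ⇐ U1 (Killing extension inward from the Rellich zone) → U2/U3 (rigidity of
## the resulting stationary vacuum black hole; Lichnerowicz/Anderson in the complete case)", typed over Chruściel–Costa's
## `M_ext`)

Write `Mext := Φ '' {R₁ < r}` for the image of the STATIONARY ZONE of the eternal far chart (the sub-cylinder on which the
chart carries the timelike coordinate Killing field `T`; Chruściel–Costa's `M_ext`, Astérisque 321 (2008) (2.1)). U as typed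
feeds `Set.range Φ` (the whole chart) to `docOfEnd` / `blackHoleRegionOfEnd`; the mathematics lives on `Mext`. Hence:

* `stub_killingExtension` (E, U1+U2 of the route plan; LOAD-BEARING and the frontier): under U's hypotheses (Ricci-flat,
  globally hyperbolic, eternal far chart `C^k·(1/r)`-close to Schwarzschild, two-sided non-radiating at order `1/r`, `T`
  timelike coordinate-Killing on `{r > R₁}`, black hole w.r.t. `Mext` or geodesically complete) there is a vector field `K`
  on `𝓢` which is a Killing field ON THE DOMAIN OF OUTER COMMUNICATIONS `⟨⟨Mext⟩⟩` (`IsKillingFieldOn`, not global: the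
  black-hole interior of an ω-limit need not be stationary) and is future-directed timelike on the stationary zone.
  Unconditional to the pseudoconvexity radius (Alexakis arXiv:0902.1131, vacuum unique continuation from infinity); through
  the trapped region to `𝓔⁺` it is the Ionescu–Klainerman frontier (local extension across 𝓗⁺ can fail, arXiv:1108.3575),
  to be paid for by eternity + two-sided non-radiation — exactly the route's bet.
* `stub_blackHoleRigidity` (R_bh, U3): a Ricci-flat globally hyperbolic spacetime with such an AF stationary end and a
  Killing field on `⟨⟨Mext⟩⟩` timelike on the stationary zone, possessing a black hole (`blackHoleRegionOfEnd Mext ≠ ∅`),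
  has `⟨⟨Mext⟩⟩` isometric to a Kerr exterior, `0 < M'`, `|a| ≤ M'` — stationary vacuum black-hole uniqueness WITHOUT
  analyticity, non-degeneracy or connectedness hypotheses (Chruściel–Costa 2008 Thm 1.3 needs all three + I⁺-regularity;
  Alexakis–Ionescu–Klainerman 2010 only near Kerr; Chruściel–Costa–Heusler 2012 §3 lists the open cases).
* `stub_completeRigidity` (R_c): the same with "black hole" replaced by timelike + null geodesic completeness concludes
  that `𝓢` is globally isometric to Minkowski space (Lichnerowicz 1955 / Anderson 2000 Thm 0.1 need the Killing field
  timelike EVERYWHERE; here it is only known on `⟨⟨Mext⟩⟩` and timelike near infinity — the large-data no-geon gap).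
* `stub_chartPlacement` (P, TYPING BRIDGE — see the flag below): under U's hypotheses the whole far chart and its
  stationary zone have the same domain of outer communications, `⟨⟨range Φ⟩⟩ = ⟨⟨Mext⟩⟩`.

`EternalStationaryExteriorIsKerr_of` (sorry-free, ≈ 25 lines): choose `k := max k_E (max k_B k_C)` and restrict the
`C^k` hypotheses to each stub's order; prenex U's `∃ (R₁, T)`; black-hole regions are ANTITONE in the end
(`B(range Φ) ⊆ B(Mext)`, `chronologicalFuture_mono`), so U's "hole-or-complete" disjunct transfers to `Mext`; E gives `K`;
R_bh resp. R_c conclude on `⟨⟨Mext⟩⟩`; P moves the Kerr isometry back to `⟨⟨range Φ⟩⟩`.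

## Registrar's flag (for the tenure / route-repair planner; NOT acted on here — the crux is fixed for this seat)

U AS TYPED IS REFUTED-MISSTATED ON PAPER, three times independently (refuter rattack g0 2026-08-15T16:41Z, rattack g2
20:16Z, route-review rreview1 2026-08-16T23:34Z; evidence EVIDENCE.md / Cprime.lean / W.lean / UPrime.lean on the item):
witness = Schwarzschild_{M₂} on the ingoing Eddington–Finkelstein patch, background mass `M := 0`, `R := M₂ < 2M₂`,
`Φ` = inclusion of the HORIZON-PENETRATING eternal cylinder `ℝ × {|x| > M₂}`; every hypothesis holds for every `k`, but
`⟨⟨range Φ⟩⟩ ⊇ range Φ` contains interior points, so neither disjunct of the conclusion holds. The repaired statement U′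
(refuters' `EternalStationaryExteriorIsKerrPrime`: `(R₁, T)` prenexed, `Mext` in place of `Set.range Φ` in BOTH
`blackHoleRegionOfEnd` and `docOfEnd`) is missed by the witness and is NOT YET FILED (route rev 10 still carries U).
This skeleton is cut so that the defect is ISOLATED: stubs E, R_bh, R_c are stated over `Mext` and compose VERBATIM to U′
(they are the skeleton of the repaired crux), while `stub_chartPlacement` carries the whole typing defect — it is FALSE
for horizon-penetrating charts (same witness) and must not be staffed; after the restatement U ↦ U′ it disappears (U′ =
E + R_bh + R_c by the proof below minus the `hdoc` line), after U ↦ U″ (U + visibility hypothesis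
`range Φ ⊆ ⟨⟨Mext⟩⟩`) it becomes a two-line lemma (transitivity of `≪`).

Disproof used: none exists (`ledger crux ls stmt-FinalStateConjecture-10745`: no workfiles before this one; no
`Theorems/EternalStationaryExteriorIsKerr/Negative/`; `ledger negatives --problem FinalStateConjecture` has no statement
about stationary exteriors). Dead lines: none recorded for this crux.
-/

noncomputable section

-- D-0017: single-problem summit, `Summit.<S>.<S>.…` by design (cf. lakefile `weak.linter.dupNamespace`).
set_option linter.dupNamespace false

namespace Summit.FinalStateConjecture.FinalStateConjecture.Cruxes.EternalStationaryExteriorIsKerr.Birth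

open Set Function Filter Literature.Geometry.Lorentzian
open scoped Manifold ContDiff Topology

/-! ## §1 The stubs -/

/-- **Stub P — chart placement (TYPING BRIDGE; carries the known defect of U as typed, do not staff).** Under U's
hypotheses (Ricci-flat, globally hyperbolic `𝓢`; injective local diffeomorphism `Φ` of the eternal cylinder
`Kerr.region 0 R`; a vector field `T` smooth, timelike and coordinate-Killing for the pulled-back metric on the stationary
zone `{r > R₁}`; black hole w.r.t. `range Φ` or geodesically complete) the far chart and its stationary zone have the
same domain of outer communications: `⟨⟨range Φ⟩⟩ = ⟨⟨Φ '' {r > R₁}⟩⟩`. TRUE when the chart lies in the d.o.c. of its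
stationary zone (then both `I^±` agree by transitivity of `≪`); FALSE as stated for a horizon-penetrating chart
(refuters' witness on the item: Schwarzschild EF patch, `M := 0`, `R := M₂`, cylinder `{|x| > M₂}`), which is exactly why
U is refuted-misstated as typed. Kept as a named stub so that the defect is isolated from the mathematics (stubs E, R_bh,
R_c); it vanishes under the pending restatement U ↦ U′ (`Mext` form). Sources: ChruscielCosta2008 §2.1–2.2 (M_ext,
⟨⟨M_ext⟩⟩); item evidence EVIDENCE.md / UPrime.lean (2026-08-15/16). -/
theorem stub_chartPlacement : ∀ (M R : ℝ), 0 ≤ M → max (2 * M) 0 < R → ∀ (𝓢 : Literature.Geometry.Lorentzian.Spacetime.{0} 4) [𝓢.metric.toPseudoRiemannianMetric.HasLeviCivita], 𝓢.metric.toPseudoRiemannianMetric.IsRicciFlat → 𝓢.metric.IsGloballyHyperbolic 𝓢.timeOrientation → ∀ (Φ : Literature.Geometry.Lorentzian.Kerr.region (0 : ℝ) R → 𝓢.carrier), IsLocalDiffeomorph 𝓘(ℝ, Literature.Geometry.Lorentzian.E4) (𝓡 4) (⊤ : ℕ∞) Φ → Function.Injective Φ → let B : Literature.Geometry.Lorentzian.ModelBackground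 := ⟨Literature.Geometry.Lorentzian.Kerr.region 0 R, Literature.Geometry.Lorentzian.Kerr.bilin M 0, fun x ↦ x 0, Literature.Geometry.Lorentzian.Kerr.radius 0⟩; let h : Literature.Geometry.Lorentzian.E4 → Literature.Geometry.Lorentzian.E4 →L[ℝ] Literature.Geometry.Lorentzian.E4 →L[ℝ] ℝ := 𝓢.deviationExtend B Φ; ∀ (R₁ : ℝ) (T : Literature.Geometry.Lorentzian.E4 → Literature.Geometry.Lorentzian.E4), R ≤ R₁ → ContDiffOn ℝ (⊤ : ℕ∞) T {y | R₁ < Literature.Geometry.Lorentzian.Kerr.radius 0 y} → (∀ y : Literature.Geometry.Lorentzian.E4, R₁ < Literature.Geometry.Lorentzian.Kerr.radius 0 y → (h y + Literature.Geometry.Lorentzian.Kerr.bilin M 0 y) (T y) (T y) < 0 ∧ ∀ v w : Literature.Geometry.Lorentzian.E4, (fderiv ℝ (fun z ↦ h z + Literature.Geometry.Lorentzian.Kerr.bilin M 0 z) y (T y)) v w + (h y + Literature.Geometry.Lorentzian.Kerr.bilin M 0 y) (fderiv ℝ T y v) w + (h y + Literature.Geometry.Lorentzian.Kerr.bilin M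 0 y) v (fderiv ℝ T y w) = 0) → ((𝓢.blackHoleRegionOfEnd (Set.range Φ)).Nonempty ∨ (𝓢.metric.IsTimelikeGeodesicallyComplete ∧ 𝓢.metric.IsNullGeodesicallyComplete)) → 𝓢.docOfEnd (Set.range Φ) = 𝓢.docOfEnd (Φ '' {x | R₁ < Literature.Geometry.Lorentzian.Kerr.radius 0 x.1}) := by
  sorry

/-- **Stub E — Killing extension to the domain of outer communications (LOAD-BEARING; the frontier).** There is a finite
`k` such that: for a Ricci-flat, globally hyperbolic spacetime `𝓢` carrying an eternal far chart `Φ` (injective local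
diffeomorphism of `Kerr.region 0 R = ℝ × {|x| > R}`) whose deviation `h` from Schwarzschild_M obeys `‖D^m h‖·r ≤ C`
(`m ≤ k`, uniformly in `t`) and is two-sided non-radiating at order `1/r` (`r‖D^m ∂₀h‖ → 0`, `m < k`), with a smooth
vector field `T` timelike and coordinate-Killing for `h + g_M` on the stationary zone `{r > R₁}`, and which has a black
hole w.r.t. `Mext := Φ '' {r > R₁}` or is timelike- and null-geodesically complete, there is a vector field `K` on `𝓢`
which is a Killing field of `g` ON `⟨⟨Mext⟩⟩ = I⁺(Mext) ∩ I⁻(Mext)` (`IsKillingFieldOn`; nothing is claimed in the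
black-hole region) and is future-directed timelike at every point of the stationary zone. Mechanism foreseen by the
route: push `T` forward (fix its sign by connectedness of the zone), extend inward by vacuum unique continuation from
infinity (Alexakis arXiv:0902.1131: unconditional to the pseudoconvexity radius), then through the trapped region and up
to `𝓔⁺` using the time-regularity that eternity + two-sided non-radiation must supply. Why it might fail: Ionescu–
Klainerman (arXiv:1108.3575; barrier `IonescuKlainermanNonExtension`) — smooth vacuum Killing fields need not extend
across characteristic hypersurfaces, so the step through trapping/𝓗⁺ is open; Alinhac–Baouendi non-uniqueness for
non-pseudoconvex continuation. Sources: arXiv:0902.1131, AlexakisIonescuKlainerman2009 (arXiv:0904.0982),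
IonescuKlainerman2012, arXiv:1504.04592 §1. -/
theorem stub_killingExtension : ∃ k : ℕ, ∀ (M R C : ℝ), 0 ≤ M → max (2 * M) 0 < R → ∀ (𝓢 : Literature.Geometry.Lorentzian.Spacetime.{0} 4) [𝓢.metric.toPseudoRiemannianMetric.HasLeviCivita], 𝓢.metric.toPseudoRiemannianMetric.IsRicciFlat → 𝓢.metric.IsGloballyHyperbolic 𝓢.timeOrientation → ∀ (Φ : Literature.Geometry.Lorentzian.Kerr.region (0 : ℝ) R → 𝓢.carrier), IsLocalDiffeomorph 𝓘(ℝ, Literature.Geometry.Lorentzian.E4) (𝓡 4) (⊤ : ℕ∞) Φ → Function.Injective Φ → let B : Literature.Geometry.Lorentzian.ModelBackground := ⟨Literature.Geometry.Lorentzian.Kerr.region 0 R, Literature.Geometry.Lorentzian.Kerr.bilin M 0, fun x ↦ x 0, Literature.Geometry.Lorentzian.Kerr.radius 0⟩; let h : Literature.Geometry.Lorentzian.E4 → Literature.Geometry.Lorentzian.E4 →L[ℝ] Literature.Geometry.Lorentzian.E4 →L[ℝ] ℝ := 𝓢.deviationExtend B Φ; let hₜ : Literature.Geometry.Lorentzian.E4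 → Literature.Geometry.Lorentzian.E4 →L[ℝ] Literature.Geometry.Lorentzian.E4 →L[ℝ] ℝ := fun y ↦ fderiv ℝ h y (Literature.Geometry.Lorentzian.E4.basisVector 0); (∀ m ≤ k, ∀ x : Literature.Geometry.Lorentzian.Kerr.region (0 : ℝ) R, ‖iteratedFDeriv ℝ m h x.1‖ * Literature.Geometry.Lorentzian.Kerr.radius 0 x.1 ≤ C) → (∀ m < k, ∀ δ > (0 : ℝ), ∃ R' : ℝ, ∀ x : Literature.Geometry.Lorentzian.Kerr.region (0 : ℝ) R, R' < Literature.Geometry.Lorentzian.Kerr.radius 0 x.1 → ‖iteratedFDeriv ℝ m hₜ x.1‖ * Literature.Geometry.Lorentzian.Kerr.radius 0 x.1 ≤ δ) → ∀ (R₁ : ℝ) (T : Literature.Geometry.Lorentzian.E4 → Literature.Geometry.Lorentzian.E4), R ≤ R₁ → ContDiffOn ℝ (⊤ : ℕ∞) T {y | R₁ < Literature.Geometry.Lorentzian.Kerr.radius 0 y} → (∀ y : Literature.Geometry.Lorentzian.E4, R₁ < Literature.Geometry.Lorentzian.Kerr.radius 0 y → (h y + Literature.Geometry.Lorentzian.Kerr.bilin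 M 0 y) (T y) (T y) < 0 ∧ ∀ v w : Literature.Geometry.Lorentzian.E4, (fderiv ℝ (fun z ↦ h z + Literature.Geometry.Lorentzian.Kerr.bilin M 0 z) y (T y)) v w + (h y + Literature.Geometry.Lorentzian.Kerr.bilin M 0 y) (fderiv ℝ T y v) w + (h y + Literature.Geometry.Lorentzian.Kerr.bilin M 0 y) v (fderiv ℝ T y w) = 0) → ((𝓢.blackHoleRegionOfEnd (Φ '' {x | R₁ < Literature.Geometry.Lorentzian.Kerr.radius 0 x.1})).Nonempty ∨ (𝓢.metric.IsTimelikeGeodesicallyComplete ∧ 𝓢.metric.IsNullGeodesicallyComplete)) → ∃ K : (Π x : 𝓢.carrier, TangentSpace (𝓡 4) x), 𝓢.metric.toPseudoRiemannianMetric.IsKillingFieldOn K (𝓢.docOfEnd (Φ '' {x | R₁ < Literature.Geometry.Lorentzian.Kerr.radius 0 x.1})) ∧ ∀ x : Literature.Geometry.Lorentzian.Kerr.region (0 : ℝ) R, R₁ < Literature.Geometry.Lorentzian.Kerr.radius 0 x.1 → 𝓢.metric.IsTimelike (K (Φ x)) ∧ 𝓢.timeOrientation.IsFutureDirected (K (Φ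 x)) := by
  sorry

/-- **Stub R_bh — stationary vacuum black-hole rigidity on the d.o.c., without analyticity (U3).** There is a finite `k`
such that: a Ricci-flat, globally hyperbolic spacetime `𝓢` with an eternal far chart `Φ` whose deviation from
Schwarzschild_M is `C^k·(1/r)`-bounded uniformly in time (an asymptotically flat END, no smallness), a vector field `K`
which is a Killing field of `g` on `⟨⟨Mext⟩⟩`, `Mext := Φ '' {r > R₁}`, future-directed timelike on the stationary zone,
and a black hole (`blackHoleRegionOfEnd Mext ≠ ∅`), has `⟨⟨Mext⟩⟩` equal to the range of an injective local isometry
from a Kerr exterior `Kerr.exterior M' a`, `0 < M'`, `|a| ≤ M'` (extremal allowed; ONE hole: multi-component equilibria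
are denied). This is black-hole uniqueness for smooth stationary vacuum with NO analyticity (Hawking rigidity),
NO non-degeneracy, NO connectedness and NO I⁺-regularity hypothesis — global hyperbolicity of the carrier and eternity
of the end stand in for them. Why it might fail: every printed theorem needs one of the missing hypotheses
(ChruscielCosta2008 Thm 1.3: analytic + I⁺-regular + connected mean-non-degenerate; AlexakisIonescuKlainerman2009:
perturbative; arXiv:1105.5830: two components only); a smooth stationary vacuum exterior with hair near a degenerate or
disconnected horizon would kill it and U with it. Sources: ChruscielCosta2008 Thm 1.3, ChruscielCostaHeusler2012 §3,
AlexakisIonescuKlainerman2009, arXiv:1105.5830, Heusler1996 Ch. 6. -/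
theorem stub_blackHoleRigidity : ∃ k : ℕ, ∀ (M R C : ℝ), 0 ≤ M → max (2 * M) 0 < R → ∀ (𝓢 : Literature.Geometry.Lorentzian.Spacetime.{0} 4) [𝓢.metric.toPseudoRiemannianMetric.HasLeviCivita] [Literature.Geometry.Lorentzian.Kerr.Facts], 𝓢.metric.toPseudoRiemannianMetric.IsRicciFlat → 𝓢.metric.IsGloballyHyperbolic 𝓢.timeOrientation → ∀ (Φ : Literature.Geometry.Lorentzian.Kerr.region (0 : ℝ) R → 𝓢.carrier), IsLocalDiffeomorph 𝓘(ℝ, Literature.Geometry.Lorentzian.E4) (𝓡 4) (⊤ : ℕ∞) Φ → Function.Injective Φ → let B : Literature.Geometry.Lorentzian.ModelBackground := ⟨Literature.Geometry.Lorentzian.Kerr.region 0 R, Literature.Geometry.Lorentzian.Kerr.bilin M 0, fun x ↦ x 0, Literature.Geometry.Lorentzian.Kerr.radius 0⟩; let h : Literature.Geometry.Lorentzian.E4 → Literature.Geometry.Lorentzian.E4 →L[ℝ] Literature.Geometry.Lorentzian.E4 →L[ℝ] ℝ := 𝓢.deviationExtend B Φ; (∀ m ≤ k, ∀ x : Literature.Geometry.Lorentzian.Kerr.region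 (0 : ℝ) R, ‖iteratedFDeriv ℝ m h x.1‖ * Literature.Geometry.Lorentzian.Kerr.radius 0 x.1 ≤ C) → ∀ (R₁ : ℝ), R ≤ R₁ → ∀ (K : (Π x : 𝓢.carrier, TangentSpace (𝓡 4) x)), 𝓢.metric.toPseudoRiemannianMetric.IsKillingFieldOn K (𝓢.docOfEnd (Φ '' {x | R₁ < Literature.Geometry.Lorentzian.Kerr.radius 0 x.1})) → (∀ x : Literature.Geometry.Lorentzian.Kerr.region (0 : ℝ) R, R₁ < Literature.Geometry.Lorentzian.Kerr.radius 0 x.1 → 𝓢.metric.IsTimelike (K (Φ x)) ∧ 𝓢.timeOrientation.IsFutureDirected (K (Φ x))) → (𝓢.blackHoleRegionOfEnd (Φ '' {x | R₁ < Literature.Geometry.Lorentzian.Kerr.radius 0 x.1})).Nonempty → ∃ (M' a : ℝ), 0 < M' ∧ |a| ≤ M' ∧ ∃ Ψ : Literature.Geometry.Lorentzian.Kerr.exterior M' a → 𝓢.carrier, Function.Injective Ψ ∧ Set.range Ψ = 𝓢.docOfEnd (Φ '' {x | R₁ < Literature.Geometry.Lorentzian.Kerr.radius 0 x.1}) ∧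 Literature.Geometry.Lorentzian.PseudoRiemannianMetric.IsLocalIsometry (Literature.Geometry.Lorentzian.Kerr.smoothMetric M' a (Literature.Geometry.Lorentzian.Kerr.rPlus M' a)).toPseudoRiemannianMetric 𝓢.metric.toPseudoRiemannianMetric Ψ := by
  sorry

/-- **Stub R_c — rigidity in the complete case: no eternal vacuum geon.** There is a finite `k` such that: a Ricci-flat,
globally hyperbolic spacetime `𝓢` with an eternal far chart `Φ` (`C^k·(1/r)`-bounded deviation from Schwarzschild_M,
uniformly in time), a vector field `K` Killing on `⟨⟨Mext⟩⟩` (`Mext := Φ '' {r > R₁}`) and future-directed timelike on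
the stationary zone, which is timelike- and null-geodesically complete, is globally isometric to Minkowski space
(`Diffeomorph` onto `E4` pulling `η` back to `g`). Lichnerowicz 1955 §90 (AF, globally static/stationary, complete ⇒ flat)
and Anderson 2000 Thm 0.1 (tree fact `Anderson2000_stationaryVacuum_flat`: complete + chronological + GLOBALLY timelike
complete Killing ⇒ flat) both want the Killing field timelike everywhere; here it is Killing on the d.o.c. only and
timelike only near infinity, and flatness must still be upgraded to a global isometry with `(ℝ⁴, η)` (no quotients: the
eternal AF end is simply connected and embedded). Why it might fail: a complete, non-flat vacuum spacetime stationary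
near one AF end but with an ergoregion / non-stationary core and no horizon (a vacuum "geon") is not excluded by any
printed theorem at this generality (large-data gap); positive-mass + Komar arguments need a global slice the statement
does not provide. Sources: Anderson2000 (arXiv:gr-qc/0001091) Thm 0.1, Lichnerowicz1955 §90, ChruscielCostaHeusler2012
§2, BeigChrusciel1996 (Killing fields of AF ends). -/
theorem stub_completeRigidity : ∃ k : ℕ, ∀ (M R C : ℝ), 0 ≤ M → max (2 * M) 0 < R → ∀ (𝓢 : Literature.Geometry.Lorentzian.Spacetime.{0} 4) [𝓢.metric.toPseudoRiemannianMetric.HasLeviCivita], 𝓢.metric.toPseudoRiemannianMetric.IsRicciFlat → 𝓢.metric.IsGloballyHyperbolic 𝓢.timeOrientation → ∀ (Φ : Literature.Geometry.Lorentzian.Kerr.region (0 : ℝ) R → 𝓢.carrier), IsLocalDiffeomorph 𝓘(ℝ, Literature.Geometry.Lorentzian.E4) (𝓡 4) (⊤ : ℕ∞) Φ → Function.Injective Φ → let B : Literature.Geometry.Lorentzian.ModelBackground := ⟨Literature.Geometry.Lorentzian.Kerr.region 0 R, Literature.Geometry.Lorentzian.Kerr.bilin M 0, fun x ↦ x 0,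 Literature.Geometry.Lorentzian.Kerr.radius 0⟩; let h : Literature.Geometry.Lorentzian.E4 → Literature.Geometry.Lorentzian.E4 →L[ℝ] Literature.Geometry.Lorentzian.E4 →L[ℝ] ℝ := 𝓢.deviationExtend B Φ; (∀ m ≤ k, ∀ x : Literature.Geometry.Lorentzian.Kerr.region (0 : ℝ) R, ‖iteratedFDeriv ℝ m h x.1‖ * Literature.Geometry.Lorentzian.Kerr.radius 0 x.1 ≤ C) → ∀ (R₁ : ℝ), R ≤ R₁ → ∀ (K : (Π x : 𝓢.carrier, TangentSpace (𝓡 4) x)), 𝓢.metric.toPseudoRiemannianMetric.IsKillingFieldOn K (𝓢.docOfEnd (Φ '' {x | R₁ < Literature.Geometry.Lorentzian.Kerr.radius 0 x.1})) → (∀ x : Literature.Geometry.Lorentzian.Kerr.region (0 : ℝ) R, R₁ < Literature.Geometry.Lorentzian.Kerr.radius 0 x.1 → 𝓢.metric.IsTimelike (K (Φ x)) ∧ 𝓢.timeOrientation.IsFutureDirected (K (Φ x))) → 𝓢.metric.IsTimelikeGeodesicallyComplete → 𝓢.metric.IsNullGeodesicallyComplete → ∃ Ψ : Diffeomorph (𝓡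 4) 𝓘(ℝ, Literature.Geometry.Lorentzian.E4) 𝓢.carrier Literature.Geometry.Lorentzian.E4 (⊤ : ℕ∞), Literature.Geometry.Lorentzian.PseudoRiemannianMetric.IsIsometry 𝓢.metric.toPseudoRiemannianMetric (Literature.Geometry.Lorentzian.Minkowski.metric.ofLE le_top : Literature.Geometry.Lorentzian.LorentzianMetric 𝓘(ℝ, Literature.Geometry.Lorentzian.E4) (⊤ : ℕ∞) Literature.Geometry.Lorentzian.E4).toPseudoRiemannianMetric Ψ := by
  sorry

/-! ## §2 The composition (sorry-free): stubs P, E, R_bh, R_c ⟹ the route decl, by name -/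

/-- **`EternalStationaryExteriorIsKerr` from the four stubs** (the registered skeleton theorem: concludes the route decl
`Theses.EternalPapapetrou.EternalStationaryExteriorIsKerr` BY NAME, takes no hypotheses, and every `sorry` it depends on
sits inside a declared `stub_*`). Take `k := max k_E (max k_B k_C)` and restrict U's `C^k`-closeness / non-radiation
hypotheses to each stub's order; prenex `(R₁, T)`; the black-hole region is antitone in the end (`Mext ⊆ range Φ ⇒
I⁻(Mext) ⊆ I⁻(range Φ) ⇒ B(range Φ) ⊆ B(Mext)`, `LorentzianMetric.chronologicalFuture_mono` at the reversed time
orientation), so "hole w.r.t. `range Φ` or complete" gives "hole w.r.t. `Mext` or complete"; stub E supplies the Killing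
field `K` on `⟨⟨Mext⟩⟩`; in the hole case stub R_bh gives the Kerr isometry onto `⟨⟨Mext⟩⟩`, which stub P identifies
with `⟨⟨range Φ⟩⟩`; in the complete case stub R_c gives the global Minkowski isometry. -/
theorem EternalStationaryExteriorIsKerr_of :
    Summit.FinalStateConjecture.FinalStateConjecture.Theses.EternalPapapetrou.EternalStationaryExteriorIsKerr := by
  obtain ⟨kE, hE⟩ := stub_killingExtension
  obtain ⟨kB, hB⟩ := stub_blackHoleRigidity
  obtain ⟨kC, hC⟩ := stub_completeRigidity
  refine ⟨max kE (max kB kC), ?_⟩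
  intro M R C hM hR 𝓢 _ _ hRic hGH Φ hΦ hinj B h hₜ hbd hnr hKill hBH
  obtain ⟨R₁, T, hR₁, hT, hKT⟩ := hKill
  -- (P) the far chart and its stationary zone `Mext := Φ '' {r > R₁}` have the same d.o.c.
  have hdoc : 𝓢.docOfEnd (Set.range Φ) =
      𝓢.docOfEnd (Φ '' {x | R₁ < Literature.Geometry.Lorentzian.Kerr.radius 0 x.1}) :=
    stub_chartPlacement M R hM hR 𝓢 hRic hGH Φ hΦ hinj R₁ T hR₁ hT hKT hBH
  -- black-hole regions are antitone in the end: `B(range Φ) ⊆ B(Mext)`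
  have hBHsub : 𝓢.blackHoleRegionOfEnd (Set.range Φ) ⊆
      𝓢.blackHoleRegionOfEnd (Φ '' {x | R₁ < Literature.Geometry.Lorentzian.Kerr.radius 0 x.1}) :=
    Set.compl_subset_compl.mpr
      (Literature.Geometry.Lorentzian.LorentzianMetric.chronologicalFuture_mono (Set.image_subset_range _ _))
  have hBH' : (𝓢.blackHoleRegionOfEnd (Φ '' {x | R₁ < Literature.Geometry.Lorentzian.Kerr.radius 0 x.1})).Nonempty ∨
      (𝓢.metric.IsTimelikeGeodesicallyComplete ∧ 𝓢.metric.IsNullGeodesicallyComplete) :=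
    hBH.imp (fun hne ↦ hne.mono hBHsub) id
  -- (E) Killing extension to `⟨⟨Mext⟩⟩`, at order `kE ≤ k`
  obtain ⟨K, hK, hKt⟩ := hE M R C hM hR 𝓢 hRic hGH Φ hΦ hinj
    (fun m hm ↦ hbd m (hm.trans (le_max_left _ _)))
    (fun m hm ↦ hnr m (lt_of_lt_of_le hm (le_max_left _ _))) R₁ T hR₁ hT hKT hBH'
  rcases hBH' with hbh | ⟨htc, hnc⟩
  · -- (R_bh) black-hole rigidity on `⟨⟨Mext⟩⟩` at order `kB ≤ k`, moved back to `⟨⟨range Φ⟩⟩` by (P)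
    obtain ⟨M', a, hM', ha, Ψ, hΨi, hΨr, hΨl⟩ := hB M R C hM hR 𝓢 hRic hGH Φ hΦ hinj
      (fun m hm ↦ hbd m (hm.trans ((le_max_left kB kC).trans (le_max_right kE _)))) R₁ hR₁ K hK hKt hbh
    exact Or.inl ⟨M', a, hM', ha, Ψ, hΨi, hΨr.trans hdoc.symm, hΨl⟩
  · -- (R_c) the complete case at order `kC ≤ k`: Minkowski
    exact Or.inr (hC M R C hM hR 𝓢 hRic hGH Φ hΦ hinj
      (fun m hm ↦ hbd m (hm.trans ((le_max_right kB kC).trans (le_max_right kE _)))) R₁ hR₁ K hK hKt htc hnc)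


/-! ## §3 The curried reading of BC3 and the repaired crux U′ -/

/-- **The curried reading of BC3** — `stub_P-sig → stub_E-sig → stub_R_bh-sig → stub_R_c-sig → U`, kernel-checked and
sorry-free (the four hypothesis types are, token for token, the signatures of the stubs of §1; the body is the proof of
`EternalStationaryExteriorIsKerr_of` with the stubs replaced by the hypotheses). Stated as an `example` so that the
skeleton audit reads the hypothesis-free `EternalStationaryExteriorIsKerr_of` above as THE skeleton theorem. -/
example :
    (∀ (M R : ℝ), 0 ≤ M → max (2 * M) 0 < R → ∀ (𝓢 : Literature.Geometry.Lorentzian.Spacetime.{0} 4) [𝓢.metric.toPseudoRiemannianMetric.HasLeviCivita], 𝓢.metric.toPseudoRiemannianMetric.IsRicciFlat → 𝓢.metric.IsGloballyHyperbolic 𝓢.timeOrientation → ∀ (Φ : Literature.Geometry.Lorentzian.Kerr.region (0 : ℝ) R → 𝓢.carrier), IsLocalDiffeomorph 𝓘(ℝ, Literature.Geometry.Lorentzian.E4) (𝓡 4) (⊤ : ℕ∞) Φ → Function.Injective Φ → let B : Literature.Geometry.Lorentzian.ModelBackground := ⟨Literature.Geometry.Lorentzian.Kerr.region 0 R, Literature.Geometry.Lorentzian.Kerr.bilin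 M 0, fun x ↦ x 0, Literature.Geometry.Lorentzian.Kerr.radius 0⟩; let h : Literature.Geometry.Lorentzian.E4 → Literature.Geometry.Lorentzian.E4 →L[ℝ] Literature.Geometry.Lorentzian.E4 →L[ℝ] ℝ := 𝓢.deviationExtend B Φ; ∀ (R₁ : ℝ) (T : Literature.Geometry.Lorentzian.E4 → Literature.Geometry.Lorentzian.E4), R ≤ R₁ → ContDiffOn ℝ (⊤ : ℕ∞) T {y | R₁ < Literature.Geometry.Lorentzian.Kerr.radius 0 y} → (∀ y : Literature.Geometry.Lorentzian.E4, R₁ < Literature.Geometry.Lorentzian.Kerr.radius 0 y → (h y + Literature.Geometry.Lorentzian.Kerr.bilin M 0 y) (T y) (T y) < 0 ∧ ∀ v w : Literature.Geometry.Lorentzian.E4, (fderiv ℝ (fun z ↦ h z + Literature.Geometry.Lorentzian.Kerr.bilin M 0 z) y (T y)) v w + (h y + Literature.Geometry.Lorentzian.Kerr.bilin M 0 y) (fderiv ℝ T y v) w + (h y + Literature.Geometry.Lorentzian.Kerr.bilin M 0 y) v (fderiv ℝ T y w) = 0) → ((𝓢.blackHoleRegionOfEnd (Set.range Φ)).Nonempty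 ∨ (𝓢.metric.IsTimelikeGeodesicallyComplete ∧ 𝓢.metric.IsNullGeodesicallyComplete)) → 𝓢.docOfEnd (Set.range Φ) = 𝓢.docOfEnd (Φ '' {x | R₁ < Literature.Geometry.Lorentzian.Kerr.radius 0 x.1})) →
    (∃ k : ℕ, ∀ (M R C : ℝ), 0 ≤ M → max (2 * M) 0 < R → ∀ (𝓢 : Literature.Geometry.Lorentzian.Spacetime.{0} 4) [𝓢.metric.toPseudoRiemannianMetric.HasLeviCivita], 𝓢.metric.toPseudoRiemannianMetric.IsRicciFlat → 𝓢.metric.IsGloballyHyperbolic 𝓢.timeOrientation → ∀ (Φ : Literature.Geometry.Lorentzian.Kerr.region (0 : ℝ) R → 𝓢.carrier), IsLocalDiffeomorph 𝓘(ℝ, Literature.Geometry.Lorentzian.E4) (𝓡 4) (⊤ : ℕ∞) Φ → Function.Injective Φ → let B : Literature.Geometry.Lorentzian.ModelBackground := ⟨Literature.Geometry.Lorentzian.Kerr.region 0 R, Literature.Geometry.Lorentzian.Kerr.bilin M 0, fun x ↦ x 0, Literature.Geometry.Lorentzian.Kerr.radius 0⟩; let h : Literature.Geometry.Lorentzian.E4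 → Literature.Geometry.Lorentzian.E4 →L[ℝ] Literature.Geometry.Lorentzian.E4 →L[ℝ] ℝ := 𝓢.deviationExtend B Φ; let hₜ : Literature.Geometry.Lorentzian.E4 → Literature.Geometry.Lorentzian.E4 →L[ℝ] Literature.Geometry.Lorentzian.E4 →L[ℝ] ℝ := fun y ↦ fderiv ℝ h y (Literature.Geometry.Lorentzian.E4.basisVector 0); (∀ m ≤ k, ∀ x : Literature.Geometry.Lorentzian.Kerr.region (0 : ℝ) R, ‖iteratedFDeriv ℝ m h x.1‖ * Literature.Geometry.Lorentzian.Kerr.radius 0 x.1 ≤ C) → (∀ m < k, ∀ δ > (0 : ℝ), ∃ R' : ℝ, ∀ x : Literature.Geometry.Lorentzian.Kerr.region (0 : ℝ) R, R' < Literature.Geometry.Lorentzian.Kerr.radius 0 x.1 → ‖iteratedFDeriv ℝ m hₜ x.1‖ * Literature.Geometry.Lorentzian.Kerr.radius 0 x.1 ≤ δ) → ∀ (R₁ : ℝ) (T : Literature.Geometry.Lorentzian.E4 → Literature.Geometry.Lorentzian.E4), R ≤ R₁ → ContDiffOn ℝ (⊤ : ℕ∞) T {y | R₁ < Literature.Geometry.Lorentzian.Kerr.radius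 0 y} → (∀ y : Literature.Geometry.Lorentzian.E4, R₁ < Literature.Geometry.Lorentzian.Kerr.radius 0 y → (h y + Literature.Geometry.Lorentzian.Kerr.bilin M 0 y) (T y) (T y) < 0 ∧ ∀ v w : Literature.Geometry.Lorentzian.E4, (fderiv ℝ (fun z ↦ h z + Literature.Geometry.Lorentzian.Kerr.bilin M 0 z) y (T y)) v w + (h y + Literature.Geometry.Lorentzian.Kerr.bilin M 0 y) (fderiv ℝ T y v) w + (h y + Literature.Geometry.Lorentzian.Kerr.bilin M 0 y) v (fderiv ℝ T y w) = 0) → ((𝓢.blackHoleRegionOfEnd (Φ '' {x | R₁ < Literature.Geometry.Lorentzian.Kerr.radius 0 x.1})).Nonempty ∨ (𝓢.metric.IsTimelikeGeodesicallyComplete ∧ 𝓢.metric.IsNullGeodesicallyComplete)) → ∃ K : (Π x : 𝓢.carrier, TangentSpace (𝓡 4) x), 𝓢.metric.toPseudoRiemannianMetric.IsKillingFieldOn K (𝓢.docOfEnd (Φ '' {x | R₁ < Literature.Geometry.Lorentzian.Kerr.radius 0 x.1})) ∧ ∀ x : Literature.Geometry.Lorentzian.Kerr.region (0 : ℝ)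 R, R₁ < Literature.Geometry.Lorentzian.Kerr.radius 0 x.1 → 𝓢.metric.IsTimelike (K (Φ x)) ∧ 𝓢.timeOrientation.IsFutureDirected (K (Φ x))) →
    (∃ k : ℕ, ∀ (M R C : ℝ), 0 ≤ M → max (2 * M) 0 < R → ∀ (𝓢 : Literature.Geometry.Lorentzian.Spacetime.{0} 4) [𝓢.metric.toPseudoRiemannianMetric.HasLeviCivita] [Literature.Geometry.Lorentzian.Kerr.Facts], 𝓢.metric.toPseudoRiemannianMetric.IsRicciFlat → 𝓢.metric.IsGloballyHyperbolic 𝓢.timeOrientation → ∀ (Φ : Literature.Geometry.Lorentzian.Kerr.region (0 : ℝ) R → 𝓢.carrier), IsLocalDiffeomorph 𝓘(ℝ, Literature.Geometry.Lorentzian.E4) (𝓡 4) (⊤ : ℕ∞) Φ → Function.Injective Φ → let B : Literature.Geometry.Lorentzian.ModelBackground := ⟨Literature.Geometry.Lorentzian.Kerr.region 0 R, Literature.Geometry.Lorentzian.Kerr.bilin M 0, fun x ↦ x 0, Literature.Geometry.Lorentzian.Kerr.radius 0⟩; let h : Literature.Geometry.Lorentzian.E4 → Literature.Geometry.Lorentzian.E4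 →L[ℝ] Literature.Geometry.Lorentzian.E4 →L[ℝ] ℝ := 𝓢.deviationExtend B Φ; (∀ m ≤ k, ∀ x : Literature.Geometry.Lorentzian.Kerr.region (0 : ℝ) R, ‖iteratedFDeriv ℝ m h x.1‖ * Literature.Geometry.Lorentzian.Kerr.radius 0 x.1 ≤ C) → ∀ (R₁ : ℝ), R ≤ R₁ → ∀ (K : (Π x : 𝓢.carrier, TangentSpace (𝓡 4) x)), 𝓢.metric.toPseudoRiemannianMetric.IsKillingFieldOn K (𝓢.docOfEnd (Φ '' {x | R₁ < Literature.Geometry.Lorentzian.Kerr.radius 0 x.1})) → (∀ x : Literature.Geometry.Lorentzian.Kerr.region (0 : ℝ) R, R₁ < Literature.Geometry.Lorentzian.Kerr.radius 0 x.1 → 𝓢.metric.IsTimelike (K (Φ x)) ∧ 𝓢.timeOrientation.IsFutureDirected (K (Φ x))) → (𝓢.blackHoleRegionOfEnd (Φ '' {x | R₁ < Literature.Geometry.Lorentzian.Kerr.radius 0 x.1})).Nonempty → ∃ (M' a : ℝ), 0 < M' ∧ |a| ≤ M' ∧ ∃ Ψ : Literature.Geometry.Lorentzian.Kerr.exterior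 M' a → 𝓢.carrier, Function.Injective Ψ ∧ Set.range Ψ = 𝓢.docOfEnd (Φ '' {x | R₁ < Literature.Geometry.Lorentzian.Kerr.radius 0 x.1}) ∧ Literature.Geometry.Lorentzian.PseudoRiemannianMetric.IsLocalIsometry (Literature.Geometry.Lorentzian.Kerr.smoothMetric M' a (Literature.Geometry.Lorentzian.Kerr.rPlus M' a)).toPseudoRiemannianMetric 𝓢.metric.toPseudoRiemannianMetric Ψ) →
    (∃ k : ℕ, ∀ (M R C : ℝ), 0 ≤ M → max (2 * M) 0 < R → ∀ (𝓢 : Literature.Geometry.Lorentzian.Spacetime.{0} 4) [𝓢.metric.toPseudoRiemannianMetric.HasLeviCivita], 𝓢.metric.toPseudoRiemannianMetric.IsRicciFlat → 𝓢.metric.IsGloballyHyperbolic 𝓢.timeOrientation → ∀ (Φ : Literature.Geometry.Lorentzian.Kerr.region (0 : ℝ) R → 𝓢.carrier), IsLocalDiffeomorph 𝓘(ℝ, Literature.Geometry.Lorentzian.E4) (𝓡 4) (⊤ : ℕ∞) Φ → Function.Injective Φ → let B : Literature.Geometry.Lorentzian.ModelBackground := ⟨Literature.Geometry.Lorentzian.Kerr.region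 0 R, Literature.Geometry.Lorentzian.Kerr.bilin M 0, fun x ↦ x 0, Literature.Geometry.Lorentzian.Kerr.radius 0⟩; let h : Literature.Geometry.Lorentzian.E4 → Literature.Geometry.Lorentzian.E4 →L[ℝ] Literature.Geometry.Lorentzian.E4 →L[ℝ] ℝ := 𝓢.deviationExtend B Φ; (∀ m ≤ k, ∀ x : Literature.Geometry.Lorentzian.Kerr.region (0 : ℝ) R, ‖iteratedFDeriv ℝ m h x.1‖ * Literature.Geometry.Lorentzian.Kerr.radius 0 x.1 ≤ C) → ∀ (R₁ : ℝ), R ≤ R₁ → ∀ (K : (Π x : 𝓢.carrier, TangentSpace (𝓡 4) x)), 𝓢.metric.toPseudoRiemannianMetric.IsKillingFieldOn K (𝓢.docOfEnd (Φ '' {x | R₁ < Literature.Geometry.Lorentzian.Kerr.radius 0 x.1})) → (∀ x : Literature.Geometry.Lorentzian.Kerr.region (0 : ℝ) R, R₁ < Literature.Geometry.Lorentzian.Kerr.radius 0 x.1 → 𝓢.metric.IsTimelike (K (Φ x)) ∧ 𝓢.timeOrientation.IsFutureDirected (K (Φ x))) → 𝓢.metric.IsTimelikeGeodesicallyComplete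 → 𝓢.metric.IsNullGeodesicallyComplete → ∃ Ψ : Diffeomorph (𝓡 4) 𝓘(ℝ, Literature.Geometry.Lorentzian.E4) 𝓢.carrier Literature.Geometry.Lorentzian.E4 (⊤ : ℕ∞), Literature.Geometry.Lorentzian.PseudoRiemannianMetric.IsIsometry 𝓢.metric.toPseudoRiemannianMetric (Literature.Geometry.Lorentzian.Minkowski.metric.ofLE le_top : Literature.Geometry.Lorentzian.LorentzianMetric 𝓘(ℝ, Literature.Geometry.Lorentzian.E4) (⊤ : ℕ∞) Literature.Geometry.Lorentzian.E4).toPseudoRiemannianMetric Ψ) →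
    Summit.FinalStateConjecture.FinalStateConjecture.Theses.EternalPapapetrou.EternalStationaryExteriorIsKerr := by
  intro hP hE' hB' hC'
  obtain ⟨kE, hE⟩ := hE'
  obtain ⟨kB, hB⟩ := hB'
  obtain ⟨kC, hC⟩ := hC'
  refine ⟨max kE (max kB kC), ?_⟩
  intro M R C hM hR 𝓢 _ _ hRic hGH Φ hΦ hinj B h hₜ hbd hnr hKill hBH
  obtain ⟨R₁, T, hR₁, hT, hKT⟩ := hKill
  have hdoc : 𝓢.docOfEnd (Set.range Φ) =
      𝓢.docOfEnd (Φ '' {x | R₁ < Literature.Geometry.Lorentzian.Kerr.radius 0 x.1}) :=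
    hP M R hM hR 𝓢 hRic hGH Φ hΦ hinj R₁ T hR₁ hT hKT hBH
  have hBHsub : 𝓢.blackHoleRegionOfEnd (Set.range Φ) ⊆
      𝓢.blackHoleRegionOfEnd (Φ '' {x | R₁ < Literature.Geometry.Lorentzian.Kerr.radius 0 x.1}) :=
    Set.compl_subset_compl.mpr
      (Literature.Geometry.Lorentzian.LorentzianMetric.chronologicalFuture_mono (Set.image_subset_range _ _))
  have hBH' : (𝓢.blackHoleRegionOfEnd (Φ '' {x | R₁ < Literature.Geometry.Lorentzian.Kerr.radius 0 x.1})).Nonempty ∨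
      (𝓢.metric.IsTimelikeGeodesicallyComplete ∧ 𝓢.metric.IsNullGeodesicallyComplete) :=
    hBH.imp (fun hne ↦ hne.mono hBHsub) id
  obtain ⟨K, hK, hKt⟩ := hE M R C hM hR 𝓢 hRic hGH Φ hΦ hinj
    (fun m hm ↦ hbd m (hm.trans (le_max_left _ _)))
    (fun m hm ↦ hnr m (lt_of_lt_of_le hm (le_max_left _ _))) R₁ T hR₁ hT hKT hBH'
  rcases hBH' with hbh | ⟨htc, hnc⟩
  · obtain ⟨M', a, hM', ha, Ψ, hΨi, hΨr, hΨl⟩ := hB M R C hM hR 𝓢 hRic hGH Φ hΦ hinj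
      (fun m hm ↦ hbd m (hm.trans ((le_max_left kB kC).trans (le_max_right kE _)))) R₁ hR₁ K hK hKt hbh
    exact Or.inl ⟨M', a, hM', ha, Ψ, hΨi, hΨr.trans hdoc.symm, hΨl⟩
  · exact Or.inr (hC M R C hM hR 𝓢 hRic hGH Φ hΦ hinj
      (fun m hm ↦ hbd m (hm.trans ((le_max_right kB kC).trans (le_max_right kE _)))) R₁ hR₁ K hK hKt htc hnc)

/-- **U′ — the refuters' repaired statement of the crux** (`EternalStationaryExteriorIsKerrPrime` of the item evidence
Cprime.lean / UPrime.lean, 2026-08-15/16; reproduced here for the repair planner, NOT a route item and not filed by this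
seat): U with `(R₁, T)` prenexed and the stationary zone `Mext := Φ '' {r > R₁}` (Chruściel–Costa's `M_ext`) in place of
`Set.range Φ` in BOTH `blackHoleRegionOfEnd` and `docOfEnd`; the horizon-penetrating Schwarzschild witness misses it.
Derived mechanically from the item's signature (two textual substitutions). -/
def EternalStationaryExteriorIsKerrPrime : Prop :=
  ∃ k : ℕ, ∀ (M R C : ℝ), 0 ≤ M → max (2 * M) 0 < R → ∀ (𝓢 : Literature.Geometry.Lorentzian.Spacetime.{0} 4) [𝓢.metric.toPseudoRiemannianMetric.HasLeviCivita] [Literature.Geometry.Lorentzian.Kerr.Facts], 𝓢.metric.toPseudoRiemannianMetric.IsRicciFlat → 𝓢.metric.IsGloballyHyperbolic 𝓢.timeOrientation → ∀ (Φ : Literature.Geometry.Lorentzian.Kerr.region (0 : ℝ) R → 𝓢.carrier), IsLocalDiffeomorph 𝓘(ℝ, Literature.Geometry.Lorentzian.E4) (𝓡 4) (⊤ : ℕ∞) Φ → Function.Injective Φ → let B : Literature.Geometry.Lorentzian.ModelBackground := ⟨Literature.Geometry.Lorentzian.Kerr.region 0 R, Literature.Geometry.Lorentzian.Kerr.bilin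 M 0, fun x ↦ x 0, Literature.Geometry.Lorentzian.Kerr.radius 0⟩; let h : Literature.Geometry.Lorentzian.E4 → Literature.Geometry.Lorentzian.E4 →L[ℝ] Literature.Geometry.Lorentzian.E4 →L[ℝ] ℝ := 𝓢.deviationExtend B Φ; let hₜ : Literature.Geometry.Lorentzian.E4 → Literature.Geometry.Lorentzian.E4 →L[ℝ] Literature.Geometry.Lorentzian.E4 →L[ℝ] ℝ := fun y ↦ fderiv ℝ h y (Literature.Geometry.Lorentzian.E4.basisVector 0); (∀ m ≤ k, ∀ x : Literature.Geometry.Lorentzian.Kerr.region (0 : ℝ) R, ‖iteratedFDeriv ℝ m h x.1‖ * Literature.Geometry.Lorentzian.Kerr.radius 0 x.1 ≤ C) → (∀ m < k, ∀ δ > (0 : ℝ), ∃ R' : ℝ, ∀ x : Literature.Geometry.Lorentzian.Kerr.region (0 : ℝ) R, R' < Literature.Geometry.Lorentzian.Kerr.radius 0 x.1 → ‖iteratedFDeriv ℝ m hₜ x.1‖ * Literature.Geometry.Lorentzian.Kerr.radius 0 x.1 ≤ δ) → ∀ (R₁ : ℝ) (T : Literature.Geometry.Lorentzian.E4 → Literature.Geometry.Lorentzian.E4),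 R ≤ R₁ → ContDiffOn ℝ (⊤ : ℕ∞) T {y | R₁ < Literature.Geometry.Lorentzian.Kerr.radius 0 y} → (∀ y : Literature.Geometry.Lorentzian.E4, R₁ < Literature.Geometry.Lorentzian.Kerr.radius 0 y → (h y + Literature.Geometry.Lorentzian.Kerr.bilin M 0 y) (T y) (T y) < 0 ∧ ∀ v w : Literature.Geometry.Lorentzian.E4, (fderiv ℝ (fun z ↦ h z + Literature.Geometry.Lorentzian.Kerr.bilin M 0 z) y (T y)) v w + (h y + Literature.Geometry.Lorentzian.Kerr.bilin M 0 y) (fderiv ℝ T y v) w + (h y + Literature.Geometry.Lorentzian.Kerr.bilin M 0 y) v (fderiv ℝ T y w) = 0) → ((𝓢.blackHoleRegionOfEnd (Φ '' {x | R₁ < Literature.Geometry.Lorentzian.Kerr.radius 0 x.1})).Nonempty ∨ (𝓢.metric.IsTimelikeGeodesicallyComplete ∧ 𝓢.metric.IsNullGeodesicallyComplete)) → (∃ (M' a : ℝ), 0 < M' ∧ |a| ≤ M' ∧ ∃ Ψ : Literature.Geometry.Lorentzian.Kerr.exterior M' a → 𝓢.carrier, Function.Injective Ψ ∧ Set.range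 Ψ = 𝓢.docOfEnd (Φ '' {x | R₁ < Literature.Geometry.Lorentzian.Kerr.radius 0 x.1}) ∧ Literature.Geometry.Lorentzian.PseudoRiemannianMetric.IsLocalIsometry (Literature.Geometry.Lorentzian.Kerr.smoothMetric M' a (Literature.Geometry.Lorentzian.Kerr.rPlus M' a)).toPseudoRiemannianMetric 𝓢.metric.toPseudoRiemannianMetric Ψ) ∨ (∃ Ψ : Diffeomorph (𝓡 4) 𝓘(ℝ, Literature.Geometry.Lorentzian.E4) 𝓢.carrier Literature.Geometry.Lorentzian.E4 (⊤ : ℕ∞), Literature.Geometry.Lorentzian.PseudoRiemannianMetric.IsIsometry 𝓢.metric.toPseudoRiemannianMetric (Literature.Geometry.Lorentzian.Minkowski.metric.ofLE le_top : Literature.Geometry.Lorentzian.LorentzianMetric 𝓘(ℝ, Literature.Geometry.Lorentzian.E4) (⊤ : ℕ∞) Literature.Geometry.Lorentzian.E4).toPseudoRiemannianMetric Ψ)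

/-- **Stubs E, R_bh, R_c alone close U′** (no placement stub): the proof of `EternalStationaryExteriorIsKerr_of` minus
the `hdoc` / antitone lines. After the pending restatement U ↦ U′ this IS the birth skeleton of the repaired crux
(re-target the conclusion to the new route decl by name). -/
theorem EternalStationaryExteriorIsKerrPrime_of : EternalStationaryExteriorIsKerrPrime := by
  obtain ⟨kE, hE⟩ := stub_killingExtension
  obtain ⟨kB, hB⟩ := stub_blackHoleRigidity
  obtain ⟨kC, hC⟩ := stub_completeRigidity
  refine ⟨max kE (max kB kC), ?_⟩
  intro M R C hM hR 𝓢 _ _ hRic hGH Φ hΦ hinj B h hₜ hbd hnr R₁ T hR₁ hT hKT hBH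
  obtain ⟨K, hK, hKt⟩ := hE M R C hM hR 𝓢 hRic hGH Φ hΦ hinj
    (fun m hm ↦ hbd m (hm.trans (le_max_left _ _)))
    (fun m hm ↦ hnr m (lt_of_lt_of_le hm (le_max_left _ _))) R₁ T hR₁ hT hKT hBH
  rcases hBH with hbh | ⟨htc, hnc⟩
  · obtain ⟨M', a, hM', ha, Ψ, hΨi, hΨr, hΨl⟩ := hB M R C hM hR 𝓢 hRic hGH Φ hΦ hinj
      (fun m hm ↦ hbd m (hm.trans ((le_max_left kB kC).trans (le_max_right kE _)))) R₁ hR₁ K hK hKt hbh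
    exact Or.inl ⟨M', a, hM', ha, Ψ, hΨi, hΨr, hΨl⟩
  · exact Or.inr (hC M R C hM hR 𝓢 hRic hGH Φ hΦ hinj
      (fun m hm ↦ hbd m (hm.trans ((le_max_right kB kC).trans (le_max_right kE _)))) R₁ hR₁ K hK hKt htc hnc)

end Summit.FinalStateConjecture.FinalStateConjecture.Cruxes.EternalStationaryExteriorIsKerr.Birth

end
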